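import Literature.Geometry.Riemannian.ParabolicNhdComparison
import Literature.Geometry.Riemannian.RiemannianDistanceMidpoint
import HarnessLib

/-!
# Conventional backward parabolic neighbourhoods lie in `P*`-parabolic neighbourhoods under unit
# scale curvature control around every `P*`-point (Bamler 2020a, Cor. 9.6 (a), chained form of
# §10.2)

R. Bamler, *Entropy and heat kernel bounds on a Ricci flow background*, arXiv:2008.07093 (2020a),
§9.1, Cor. 9.6 (a) (arXiv v1 Cor. 34 (a)): `P(x₀, t₀; A r, −T⁻r², T⁺r²) ⊂ P*(x₀, t₀; A′ r, …)`
if `|Ric| ≤ K r⁻²` on the conventional neighbourhood OR on the `P*`-neighbourhood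
`P*(x₀, t₀; A′ r, …)`; in §10.2 (proof of Thm. 10.2, arXiv v1 Thm. 39) it is used in the second
form, the curvature being controlled (`r_Rm ≥ r/10`) around every point of a `P*⁻`-neighbourhood.
The tree's `exists_mem_pParabolicNhd_of_ricci_bound` (Cor. 9.6 (a), slack form: curvature bound
on the `g_{t₀}`-ball of double radius) does not directly give the second form by Bamler's maximal
radius argument; instead this file CHAINS the slack form along space–time chains of unit steps:

* `MetricFlow.IsHConcentrated.pParabolicNhd_subset_of_mem'` — Prop. 9.3 (c) with a fixed base
  time: if `x₁ ∈ P*(x₂; A₂, −T₂, T₂′)`, `T₂ ≤ T`, `𝔱(x₂) − T ≤ 𝔱(x₁) − T₁`, then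
  `P*(x₁; A₁, −T₁, T₁′) ⊆ P*(x₂; A₁ + A₂, −T, T′)` (`𝔱(x₁) + T₁′ ≤ 𝔱(x₂) + T′`);
* `exists_mem_pParabolicNhd_of_ricci_bound_chain` — **the chained Cor. 9.6 (a′)**: for `m ≥ 3`,
  `K, A₁ ≥ 0`, `T⁻₁ ≥ 1` there is `A₂ = A₂(m, K, A₁, T⁻₁) > 0` such that for every compact Ricci
  flow, `x₀`, `t₀`, `r > 0` with `a < t₀ − (T⁻₁ + 1) r²`: if `|Ric_τ| ≤ K r⁻² g_τ` on
  `B(y, s, r) × [s − r², s]` for every point `(y, s)` of `P*(x₀, t₀; A₂ r, −T⁻₁ r², 0)`, then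
  every `(x, t)` with `t ∈ [t₀ − T⁻₁ r², t₀]`, `d_{t₀}(x₀, x) < A₁ r` lies in
  `P*(x₀, t₀; A₂ r, −T⁻₁ r², 0)`. Proof: with `A′` the constant of the slack Cor. 9.6 (a) at
  `(A, T⁻, T⁺) = (1/2, 1, 0)`, one step moves from a `P*`-point `(y, s)` with `W₁`-radius `B r` to
  all `(x, t)` with `d_s(y, x) < r/2`, `t ∈ [s − r², s]`, at radius `(B + A′) r`
  (`pParabolicNhd_subset_of_mem'`); `⌈2A₁⌉ + 1` steps in space at time `t₀` (approximate
  intermediate points, `exists_edist_lt_edist_lt_of_edist_lt_add`) and `⌈2T⁻₁⌉` steps backwards in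
  time along the fixed point `x` cover the conventional neighbourhood.

Everything is proved; no definitions, no named facts.

## References

* R. H. Bamler, *Entropy and heat kernel bounds on a Ricci flow background*, arXiv:2008.07093
  (2020), §9.1, Prop. 9.3 (c), Cor. 9.6 (a) (arXiv v1 Prop. 32, Cor. 34); §10.2, proof of
  Thm. 10.2 (arXiv v1 Thm. 39). [Bamler2020Entropy]
-/

noncomputable section

open Set Filter Function MeasureTheory Measure
open scoped Manifold ContDiff Topology ENNReal NNReal

namespace Literature.Geometry.Riemannian

open Lorentzian Lorentzian.PseudoRiemannianMetric MetricFlow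

universe u

namespace MetricFlow

variable {I : Set ℝ} {𝒳 : MetricFlow.{u} I}

/-- **Prop. 9.3 (c) with a fixed base time** (Bamler 2020a, §9.2, proof of Prop. 9.3 (c):
`d^{𝔱(x₂)−T}_{W₁}(ν_{x₂}, ν_x) ≤ d^{𝔱(x₂)−T₂}_{W₁}(ν_{x₂}, ν_{x₁}) + d^{𝔱(x₁)−T₁}_{W₁}(ν_{x₁}, ν_x)`
by the triangle inequality and the monotonicity of `d_{W₁}`): if `x₁ ∈ P*(x₂; A₂, −T₂, T₂′)`,
`A₁ + A₂ ≤ A`, `T₂ ≤ T`, `𝔱(x₂) − T ≤ 𝔱(x₁) − T₁` (`T₁ ≥ 0`) and `𝔱(x₁) + T₁′ ≤ 𝔱(x₂) + T′`, then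
`P*(x₁; A₁, −T₁, T₁′) ⊆ P*(x₂; A, −T, T′)` (in an `H`-concentrated flow).
[cite: Bamler2020Entropy, §9.1, Prop. 9.3 (c)] -/
theorem IsHConcentrated.pParabolicNhd_subset_of_mem' {H : ℝ} (hH : 𝒳.IsHConcentrated H)
    {x₁ x₂ : 𝒳.Pt} {A₁ A₂ T₁ T₂ T₁' T₂' A T T' : ℝ} (hT₁ : 0 ≤ T₁) (hT₂ : 0 ≤ T₂)
    {h₂ : (x₂.1 : ℝ) - T₂ ∈ I} (hx : x₁ ∈ 𝒳.pParabolicNhd x₂ A₂ T₂ T₂' h₂) (hA : A₁ + A₂ ≤ A)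
    (hT : T₂ ≤ T) (hbase : (x₂.1 : ℝ) - T ≤ x₁.1 - T₁) (hT' : (x₁.1 : ℝ) + T₁' ≤ x₂.1 + T')
    (h₁ : (x₁.1 : ℝ) - T₁ ∈ I) (h : (x₂.1 : ℝ) - T ∈ I) :
    𝒳.pParabolicNhd x₁ A₁ T₁ T₁' h₁ ⊆ 𝒳.pParabolicNhd x₂ A T T' h := by
  intro x hx'
  have hA₁ := pos_of_mem_pParabolicNhd hx'; have hA₂ := pos_of_mem_pParabolicNhd hx
  obtain ⟨⟨ht₁, ht₂⟩, hW⟩ := hx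
  obtain ⟨⟨ht₁', ht₂'⟩, hW'⟩ := hx'
  refine ⟨⟨by linarith, by linarith⟩, ?_⟩
  calc wassersteinW1 (𝒳.condKernel x₂.2 ⟨_, h⟩) (𝒳.condKernel x.2 ⟨_, h⟩)
      ≤ wassersteinW1 (𝒳.condKernel x₂.2 ⟨_, h₂⟩) (𝒳.condKernel x₁.2 ⟨_, h₂⟩) +
          wassersteinW1 (𝒳.condKernel x₁.2 ⟨_, h₁⟩) (𝒳.condKernel x.2 ⟨_, h₁⟩) :=
        wassersteinW1_condKernel_le_add hH hbase
          (show (x₂.1 : ℝ) - T ≤ x₂.1 - T₂ by linarith) ht₁'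
          (show (x₁.1 : ℝ) - T₁ ≤ x₁.1 by linarith) ht₁ (show (x₂.1 : ℝ) - T₂ ≤ x₂.1 by linarith)
          x.2 x₁.2 x₂.2
    _ < ENNReal.ofReal A₂ + ENNReal.ofReal A₁ := ENNReal.add_lt_add hW hW'
    _ = ENNReal.ofReal (A₁ + A₂) := by rw [← ENNReal.ofReal_add hA₂.le hA₁.le, add_comm]
    _ ≤ ENNReal.ofReal A := ENNReal.ofReal_le_ofReal hA

end MetricFlow

section Chain

variable {m : ℕ} {M : Type u} [TopologicalSpace M] [ChartedSpace (EuclideanSpace ℝ (Fin m)) M]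
  [IsManifold 𝓘(ℝ, EuclideanSpace ℝ (Fin m)) ∞ M] [T2Space M] [CompactSpace M]
  [SecondCountableTopology M] [MeasurableSpace M] [BorelSpace M] [ConnectedSpace M] [T3Space M]
  {h : ℝ → PseudoRiemannianMetric 𝓘(ℝ, EuclideanSpace ℝ (Fin m)) ∞ (EuclideanSpace ℝ (Fin m))
    (TangentSpace 𝓘(ℝ, EuclideanSpace ℝ (Fin m)) : M → Type _)}
  {cov : ℝ → CovariantDerivative 𝓘(ℝ, EuclideanSpace ℝ (Fin m)) (EuclideanSpace ℝ (Fin m))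
    (TangentSpace 𝓘(ℝ, EuclideanSpace ℝ (Fin m)) : M → Type _)}
  {a T : ℝ} (hflow : IsRicciFlow h cov (Icc a T)) (hh : IsContMDiffFamilyOn ∞ h univ)
  (hR : ∀ r, (h r).IsRiemannian)

omit [T3Space M] in
/-- **One step of the chain** (Bamler 2020a, §10.2, use of Cor. 9.6 (a)): if the slack
Cor. 9.6 (a) holds at scale `r` with constant `A′` (`hsl`, from
`exists_mem_pParabolicNhd_of_ricci_bound` at `(A, T⁻, T⁺) = (1/2, 1, 0)`) and `|Ric| ≤ K r⁻²` on
`B(y, s, r) × [s − r², s]` around every point `(y, s)` of `P*(x₀, t₀; A₂ r, −T⁻₁ r², 0)`, then from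
a point `(y, s) ∈ P*(x₀, t₀; B r, −T⁻₁ r², 0)` with `B + A′ ≤ A₂`, `t₀ − T⁻₁ r² ≤ s − r²`, every
`(x, t)` with `d_s(y, x) < r/2`, `t ∈ [s − r², s]` lies in `P*(x₀, t₀; (B + A′) r, −T⁻₁ r², 0)`
(Prop. 9.3 (c) at the fixed base time, `pParabolicNhd_subset_of_mem'`).
[cite: Bamler2020Entropy, §10.2, proof of Thm. 10.2 (arXiv v1 Thm. 39), use of Cor. 9.6] -/
theorem mem_pParabolicNhd_chain_step (hm : 3 ≤ m) {t₀ r : ℝ} (ht₀ : t₀ ∈ Icc a T) {Tm₁ : ℝ}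
    (hb : t₀ - Tm₁ * r ^ 2 ∈ Icc a T) (hr : 0 < r) (has : a < t₀ - (Tm₁ + 1) * r ^ 2)
    (x₀ : M) {A' A₂ K : ℝ} (hA' : 0 < A')
    (hsl : ∀ (s t : ℝ) (hs : s ∈ Icc a T) (ht : t ∈ Icc a T) (hb' : s - 1 * r ^ 2 ∈ Icc a T),
      0 < r → a < s - 1 * r ^ 2 → s - 1 * r ^ 2 ≤ t → t ≤ s + 0 * r ^ 2 → ∀ y x : M,
      (∀ s' ∈ Icc (s - 1 * r ^ 2) (s + 0 * r ^ 2), s' ≤ T → ∀ z : M,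
        (h s).edist (hR s) y z < ENNReal.ofReal (2 * (1 / 2) * r) →
        ∀ v : TangentSpace 𝓘(ℝ, EuclideanSpace ℝ (Fin m)) z,
          |(cov s').ricci z v v| ≤ K / r ^ 2 * (h s').val z v v) →
      (h s).edist (hR s) y x < ENNReal.ofReal (1 / 2 * r) →
      (⟨⟨t, ht⟩, x⟩ : (ricciFlowMetricFlow hh hR Set.ordConnected_Icc hflow).Pt) ∈
        (ricciFlowMetricFlow hh hR Set.ordConnected_Icc hflow).pParabolicNhd ⟨⟨s, hs⟩, y⟩
          (A' * r) (1 * r ^ 2) (0 * r ^ 2) hb')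
    (hRicH : ∀ (s : ℝ) (hs : s ∈ Icc a T) (y : M),
      (⟨⟨s, hs⟩, y⟩ : (ricciFlowMetricFlow hh hR Set.ordConnected_Icc hflow).Pt) ∈
        (ricciFlowMetricFlow hh hR Set.ordConnected_Icc hflow).pParabolicNhd ⟨⟨t₀, ht₀⟩, x₀⟩
          (A₂ * r) (Tm₁ * r ^ 2) 0 hb →
      ∀ τ ∈ Icc (s - r ^ 2) s, ∀ z : M, (h s).edist (hR s) y z < ENNReal.ofReal r →
      ∀ v : TangentSpace 𝓘(ℝ, EuclideanSpace ℝ (Fin m)) z,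
        |(cov τ).ricci z v v| ≤ K / r ^ 2 * (h τ).val z v v)
    (B s : ℝ) (hs : s ∈ Icc a T) (y : M)
    (hy : (⟨⟨s, hs⟩, y⟩ : (ricciFlowMetricFlow hh hR Set.ordConnected_Icc hflow).Pt) ∈
      (ricciFlowMetricFlow hh hR Set.ordConnected_Icc hflow).pParabolicNhd ⟨⟨t₀, ht₀⟩, x₀⟩
        (B * r) (Tm₁ * r ^ 2) 0 hb)
    (hBA : B + A' ≤ A₂) (hbase : t₀ - Tm₁ * r ^ 2 ≤ s - r ^ 2) (t : ℝ) (ht : t ∈ Icc a T)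
    (hst : s - r ^ 2 ≤ t) (hts : t ≤ s) (x : M)
    (hx : (h s).edist (hR s) y x < ENNReal.ofReal (r / 2)) :
    (⟨⟨t, ht⟩, x⟩ : (ricciFlowMetricFlow hh hR Set.ordConnected_Icc hflow).Pt) ∈
      (ricciFlowMetricFlow hh hR Set.ordConnected_Icc hflow).pParabolicNhd ⟨⟨t₀, ht₀⟩, x₀⟩
        ((B + A') * r) (Tm₁ * r ^ 2) 0 hb := by
  have hmpos : 0 < m := lt_of_lt_of_le (by norm_num) hm
  have hH := ricciFlowMetricFlow_isHConcentrated hmpos hh hR Set.ordConnected_Icc hflow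
  have hr2 : 0 < r ^ 2 := pow_pos hr 2
  have hyA₂ : (⟨⟨s, hs⟩, y⟩ : (ricciFlowMetricFlow hh hR Set.ordConnected_Icc hflow).Pt) ∈
      (ricciFlowMetricFlow hh hR Set.ordConnected_Icc hflow).pParabolicNhd ⟨⟨t₀, ht₀⟩, x₀⟩
        (A₂ * r) (Tm₁ * r ^ 2) 0 hb :=
    ⟨hy.1, hy.2.trans_le (ENNReal.ofReal_le_ofReal
      (mul_le_mul_of_nonneg_right (by linarith) hr.le))⟩
  have hst₀ : s ≤ t₀ := by
    have h1 := hy.1.2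
    simp only [add_zero] at h1
    exact h1
  have hb' : s - 1 * r ^ 2 ∈ Icc a T :=
    ⟨by rw [one_mul]; linarith [hb.1], by rw [one_mul]; linarith [hs.2]⟩
  have has' : a < s - 1 * r ^ 2 := by
    have : (Tm₁ + 1) * r ^ 2 = Tm₁ * r ^ 2 + r ^ 2 := by ring
    rw [one_mul]; linarith
  have hloc := hsl s t hs ht hb' hr has' (by rw [one_mul]; exact hst)
    (by rw [zero_mul, add_zero]; exact hts) y x
    (fun s' hs' _ z hz v ↦ hRicH s hs y hyA₂ s' ⟨by linarith [hs'.1], by linarith [hs'.2]⟩ z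
      (by rwa [show 2 * (1 / 2 : ℝ) * r = r by ring] at hz) v)
    (by rwa [show (1 / 2 : ℝ) * r = r / 2 by ring])
  have hTmr : r ^ 2 ≤ Tm₁ * r ^ 2 := by
    have : (Tm₁ + 1) * r ^ 2 = Tm₁ * r ^ 2 + r ^ 2 := by ring
    linarith [hbase, hst₀]
  exact hH.pParabolicNhd_subset_of_mem' (x₁ := ⟨⟨s, hs⟩, y⟩) (x₂ := ⟨⟨t₀, ht₀⟩, x₀⟩)
    (by rw [one_mul]; exact hr2.le) (hr2.le.trans hTmr) hy (by linarith) le_rfl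
    (show t₀ - Tm₁ * r ^ 2 ≤ s - 1 * r ^ 2 by rw [one_mul]; exact hbase)
    (show s + 0 * r ^ 2 ≤ t₀ + 0 by rw [zero_mul, add_zero, add_zero]; exact hst₀) hb' hb hloc

/-- **The space chain** (Bamler 2020a, §10.2, chaining Cor. 9.6 (a) at the time `t₀`): given
the one-step implication (`hstep`, `mem_pParabolicNhd_chain_step`) with constant `A′`, for
`j + 1 ≤ N` and `1 + (N + 1) A′ ≤ A₂`, every `x` with `d_{t₀}(x₀, x) < (j + 1) r/2` and
`t ∈ [t₀ − r², t₀]` has `(x, t) ∈ P*(x₀, t₀; (1 + (j+1)A′) r, −T⁻₁ r², 0)` (induction on `j`,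
approximate intermediate points `exists_edist_lt_edist_lt_of_edist_lt_add`).
[cite: Bamler2020Entropy, §10.2, proof of Thm. 10.2 (arXiv v1 Thm. 39), use of Cor. 9.6] -/
theorem mem_pParabolicNhd_chain_space {t₀ r : ℝ} (ht₀ : t₀ ∈ Icc a T) {Tm₁ : ℝ} (hTm₁ : 1 ≤ Tm₁)
    (hb : t₀ - Tm₁ * r ^ 2 ∈ Icc a T) (hr : 0 < r) (x₀ : M) {A' A₂ N : ℝ} (hA' : 0 < A')
    (hNA : 1 + (N + 1) * A' ≤ A₂)
    (hstep : ∀ (B s : ℝ) (hs : s ∈ Icc a T) (y : M),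
      (⟨⟨s, hs⟩, y⟩ : (ricciFlowMetricFlow hh hR Set.ordConnected_Icc hflow).Pt) ∈
        (ricciFlowMetricFlow hh hR Set.ordConnected_Icc hflow).pParabolicNhd ⟨⟨t₀, ht₀⟩, x₀⟩
          (B * r) (Tm₁ * r ^ 2) 0 hb →
      B + A' ≤ A₂ → t₀ - Tm₁ * r ^ 2 ≤ s - r ^ 2 → ∀ (t : ℝ) (ht : t ∈ Icc a T),
      s - r ^ 2 ≤ t → t ≤ s → ∀ x : M, (h s).edist (hR s) y x < ENNReal.ofReal (r / 2) →
      (⟨⟨t, ht⟩, x⟩ : (ricciFlowMetricFlow hh hR Set.ordConnected_Icc hflow).Pt) ∈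
        (ricciFlowMetricFlow hh hR Set.ordConnected_Icc hflow).pParabolicNhd ⟨⟨t₀, ht₀⟩, x₀⟩
          ((B + A') * r) (Tm₁ * r ^ 2) 0 hb)
    (j : ℕ) (hjN : (j : ℝ) + 1 ≤ N) (x : M)
    (hx : (h t₀).edist (hR t₀) x₀ x < ENNReal.ofReal (((j : ℝ) + 1) * (r / 2)))
    (t : ℝ) (ht : t ∈ Icc a T) (h1 : t₀ - r ^ 2 ≤ t) (h2 : t ≤ t₀) :
    (⟨⟨t, ht⟩, x⟩ : (ricciFlowMetricFlow hh hR Set.ordConnected_Icc hflow).Pt) ∈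
      (ricciFlowMetricFlow hh hR Set.ordConnected_Icc hflow).pParabolicNhd ⟨⟨t₀, ht₀⟩, x₀⟩
        ((1 + ((j : ℝ) + 1) * A') * r) (Tm₁ * r ^ 2) 0 hb := by
  have hr2 : 0 < r ^ 2 := pow_pos hr 2
  have hTmr : r ^ 2 ≤ Tm₁ * r ^ 2 := le_mul_of_one_le_left hr2.le hTm₁
  have hbase : t₀ - Tm₁ * r ^ 2 ≤ t₀ - r ^ 2 := by linarith
  induction j generalizing x t with
  | zero =>
    have hself : (⟨⟨t₀, ht₀⟩, x₀⟩ : (ricciFlowMetricFlow hh hR Set.ordConnected_Icc hflow).Pt) ∈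
        (ricciFlowMetricFlow hh hR Set.ordConnected_Icc hflow).pParabolicNhd ⟨⟨t₀, ht₀⟩, x₀⟩
          (1 * r) (Tm₁ * r ^ 2) 0 hb :=
      MetricFlow.mem_pParabolicNhd_self _ (by rw [one_mul]; exact hr) (hr2.le.trans hTmr) le_rfl
        hb
    have hbound : 1 + A' ≤ A₂ := by
      have : (0 : ℝ) ≤ N := by have := (Nat.cast_nonneg (α := ℝ) 0); linarith
      nlinarith
    have := hstep 1 t₀ ht₀ x₀ hself hbound hbase t ht h1 h2 x
      (by rwa [Nat.cast_zero, zero_add, one_mul] at hx)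
    rwa [Nat.cast_zero, zero_add, one_mul]
  | succ j ih =>
    rw [Nat.cast_succ] at hjN hx ⊢
    obtain ⟨y, hy1, hy2⟩ := exists_edist_lt_edist_lt_of_edist_lt_add (hR t₀) x₀ x
      (a := ((j : ℝ) + 1) * (r / 2)) (b := r / 2) (mul_pos (by positivity) (half_pos hr))
      (half_pos hr)
      (by rwa [show ((j : ℝ) + 1 + 1) * (r / 2) = ((j : ℝ) + 1) * (r / 2) + r / 2 by ring] at hx)
    have hyP := ih (by linarith) y hy1 t₀ ht₀ (by linarith) le_rfl
    have hbound : 1 + ((j : ℝ) + 1) * A' + A' ≤ A₂ := by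
      have h3 : ((j : ℝ) + 1 + 1) * A' ≤ (N + 1) * A' :=
        mul_le_mul_of_nonneg_right (by linarith) hA'.le
      linarith
    have := hstep _ t₀ ht₀ y hyP hbound hbase t ht h1 h2 x hy2
    rwa [show 1 + ((j : ℝ) + 1 + 1) * A' = 1 + ((j : ℝ) + 1) * A' + A' by ring]

omit [T3Space M] in
/-- **The time chain** (Bamler 2020a, §10.2, chaining Cor. 9.6 (a) backwards in time along a
fixed point `x`): given the one-step implication (`hstep`) with constant `A′`, if
`(x, t) ∈ P*(x₀, t₀; B₀ r, −T⁻₁ r², 0)` for `t ∈ [t₀ − r², t₀]`, then for every `k ≤ K*` with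
`B₀ + K* A′ ≤ A₂` and every `t ∈ [max(t₀ − k r²/2, t₀ − T⁻₁ r² + r²) − r², t₀]`,
`(x, t) ∈ P*(x₀, t₀; (B₀ + k A′) r, −T⁻₁ r², 0)` (induction on `k`; the `k`-th step is centred at
`(x, max(t₀ − k r²/2, t₀ − T⁻₁ r² + r²))`).
[cite: Bamler2020Entropy, §10.2, proof of Thm. 10.2 (arXiv v1 Thm. 39), use of Cor. 9.6] -/
theorem mem_pParabolicNhd_chain_time {t₀ r : ℝ} (ht₀ : t₀ ∈ Icc a T) {Tm₁ : ℝ} (hTm₁ : 1 ≤ Tm₁)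
    (hb : t₀ - Tm₁ * r ^ 2 ∈ Icc a T) (hr : 0 < r) (x₀ : M) {A' A₂ B₀ Kst : ℝ} (hA' : 0 < A')
    (hKA : B₀ + Kst * A' ≤ A₂)
    (hstep : ∀ (B s : ℝ) (hs : s ∈ Icc a T) (y : M),
      (⟨⟨s, hs⟩, y⟩ : (ricciFlowMetricFlow hh hR Set.ordConnected_Icc hflow).Pt) ∈
        (ricciFlowMetricFlow hh hR Set.ordConnected_Icc hflow).pParabolicNhd ⟨⟨t₀, ht₀⟩, x₀⟩
          (B * r) (Tm₁ * r ^ 2) 0 hb →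
      B + A' ≤ A₂ → t₀ - Tm₁ * r ^ 2 ≤ s - r ^ 2 → ∀ (t : ℝ) (ht : t ∈ Icc a T),
      s - r ^ 2 ≤ t → t ≤ s → ∀ x : M, (h s).edist (hR s) y x < ENNReal.ofReal (r / 2) →
      (⟨⟨t, ht⟩, x⟩ : (ricciFlowMetricFlow hh hR Set.ordConnected_Icc hflow).Pt) ∈
        (ricciFlowMetricFlow hh hR Set.ordConnected_Icc hflow).pParabolicNhd ⟨⟨t₀, ht₀⟩, x₀⟩
          ((B + A') * r) (Tm₁ * r ^ 2) 0 hb)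
    (x : M)
    (hx : ∀ (t : ℝ) (ht : t ∈ Icc a T), t₀ - r ^ 2 ≤ t → t ≤ t₀ →
      (⟨⟨t, ht⟩, x⟩ : (ricciFlowMetricFlow hh hR Set.ordConnected_Icc hflow).Pt) ∈
        (ricciFlowMetricFlow hh hR Set.ordConnected_Icc hflow).pParabolicNhd ⟨⟨t₀, ht₀⟩, x₀⟩
          (B₀ * r) (Tm₁ * r ^ 2) 0 hb)
    (k : ℕ) (hk : (k : ℝ) ≤ Kst) (t : ℝ) (ht : t ∈ Icc a T)
    (h1 : max (t₀ - (k : ℝ) * (r ^ 2 / 2)) (t₀ - Tm₁ * r ^ 2 + r ^ 2) - r ^ 2 ≤ t) (h2 : t ≤ t₀) :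
    (⟨⟨t, ht⟩, x⟩ : (ricciFlowMetricFlow hh hR Set.ordConnected_Icc hflow).Pt) ∈
      (ricciFlowMetricFlow hh hR Set.ordConnected_Icc hflow).pParabolicNhd ⟨⟨t₀, ht₀⟩, x₀⟩
        ((B₀ + (k : ℝ) * A') * r) (Tm₁ * r ^ 2) 0 hb := by
  have hr2 : 0 < r ^ 2 := pow_pos hr 2
  have hTmr : r ^ 2 ≤ Tm₁ * r ^ 2 := le_mul_of_one_le_left hr2.le hTm₁
  have htbt₀ : t₀ - Tm₁ * r ^ 2 + r ^ 2 ≤ t₀ := by linarith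
  -- monotonicity in the radius
  have hmono : ∀ {B B' : ℝ} {t : ℝ} {ht : t ∈ Icc a T}, B ≤ B' →
      (⟨⟨t, ht⟩, x⟩ : (ricciFlowMetricFlow hh hR Set.ordConnected_Icc hflow).Pt) ∈
        (ricciFlowMetricFlow hh hR Set.ordConnected_Icc hflow).pParabolicNhd ⟨⟨t₀, ht₀⟩, x₀⟩
          (B * r) (Tm₁ * r ^ 2) 0 hb →
      (⟨⟨t, ht⟩, x⟩ : (ricciFlowMetricFlow hh hR Set.ordConnected_Icc hflow).Pt) ∈
        (ricciFlowMetricFlow hh hR Set.ordConnected_Icc hflow).pParabolicNhd ⟨⟨t₀, ht₀⟩, x₀⟩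
          (B' * r) (Tm₁ * r ^ 2) 0 hb := fun hBB' hp ↦
    ⟨hp.1, hp.2.trans_le (ENNReal.ofReal_le_ofReal (mul_le_mul_of_nonneg_right hBB' hr.le))⟩
  induction k generalizing t with
  | zero =>
    rw [Nat.cast_zero, zero_mul, sub_zero, max_eq_left htbt₀] at h1
    rw [Nat.cast_zero, zero_mul, add_zero]
    exact hx t ht h1 h2
  | succ k ih =>
    rw [Nat.cast_succ] at hk h1 ⊢
    set u : ℝ := max (t₀ - ((k : ℝ) + 1) * (r ^ 2 / 2)) (t₀ - Tm₁ * r ^ 2 + r ^ 2) with hu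
    have hu_le : u ≤ t₀ := max_le (sub_le_self _ (by positivity)) htbt₀
    have hu_ge : t₀ - Tm₁ * r ^ 2 + r ^ 2 ≤ u := le_max_right _ _
    have hu_mem : u ∈ Icc a T := ⟨by linarith [hb.1], hu_le.trans ht₀.2⟩
    have huk : max (t₀ - (k : ℝ) * (r ^ 2 / 2)) (t₀ - Tm₁ * r ^ 2 + r ^ 2) - r ^ 2 ≤ u := by
      rw [_root_.sub_le_iff_le_add]
      refine max_le ?_ ?_
      · have : t₀ - ((k : ℝ) + 1) * (r ^ 2 / 2) ≤ u := le_max_left _ _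
        linarith
      · linarith
    have hq := ih (by linarith) u hu_mem huk hu_le
    by_cases htu : t ≤ u
    · have hbound : B₀ + (k : ℝ) * A' + A' ≤ A₂ := by
        have h3 : ((k : ℝ) + 1) * A' ≤ Kst * A' := mul_le_mul_of_nonneg_right hk hA'.le
        linarith
      have := hstep _ u hu_mem x hq hbound (by linarith) t ht h1 htu x
        (by rw [PseudoRiemannianMetric.edist_self]; exact ENNReal.ofReal_pos.2 (half_pos hr))
      rwa [show B₀ + ((k : ℝ) + 1) * A' = B₀ + (k : ℝ) * A' + A' by ring]
    · rw [not_le] at htu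
      have hkk : (k : ℝ) * A' ≤ ((k : ℝ) + 1) * A' :=
        mul_le_mul_of_nonneg_right (by linarith) hA'.le
      exact hmono (by linarith [hkk]) (ih (by linarith) t ht (huk.trans htu.le) h2)

end Chain

/-- **Cor. 9.6 (a′), chained form** (Bamler 2020a, Cor. 9.6 (a) as used in §10.2): for `m ≥ 3`,
`K, A₁ ≥ 0` and `T⁻₁ ≥ 1` there is `A₂ > 0` such that for every Ricci flow `(h, cov)` on `[a, T]`
of a smooth family of Riemannian metrics on a closed connected `m`-manifold (metric flow
`𝒳 = ricciFlowMetricFlow hh hR _ hflow`), all `x₀`, `t₀ ∈ [a, T]`, `r > 0` with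
`a < t₀ − (T⁻₁ + 1) r²`: if `|Ric_τ(z)| ≤ (K/r²) g_τ(z)` for all `τ ∈ [s − r², s]`, `d_s(y, z) < r`
and all points `(y, s) ∈ P*(x₀, t₀; A₂ r, −T⁻₁ r², 0)`, then every `(x, t)` with
`t ∈ [t₀ − T⁻₁ r², t₀]` (`t ∈ [a, T]`) and `d_{t₀}(x₀, x) < A₁ r` lies in
`P*(x₀, t₀; A₂ r, −T⁻₁ r², 0)`. Proof: chaining the slack Cor. 9.6 (a)
(`exists_mem_pParabolicNhd_of_ricci_bound` at `(A, T⁻, T⁺) = (1/2, 1, 0)`) along `⌈2A₁⌉ + 1`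
space steps of `g_{t₀}`-length `< r/2` (`exists_edist_lt_edist_lt_of_edist_lt_add`) and `⌈2T⁻₁⌉`
backward time steps of length `r²/2`, composing with Prop. 9.3 (c) at the fixed base time
`t₀ − T⁻₁ r²` (`pParabolicNhd_subset_of_mem'`).
[cite: Bamler2020Entropy, §9.1, Cor. 9.6 (a); §10.2, proof of Thm. 10.2 (arXiv v1 Thm. 39)] -/
theorem exists_mem_pParabolicNhd_of_ricci_bound_chain (m : ℕ) (hm : 3 ≤ m) {K A₁ Tm₁ : ℝ}
    (hK : 0 ≤ K) (_hA₁ : 0 ≤ A₁) (hTm₁ : 1 ≤ Tm₁) :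
    ∃ A₂ : ℝ, 0 < A₂ ∧ ∀ {M : Type*} [TopologicalSpace M]
      [ChartedSpace (EuclideanSpace ℝ (Fin m)) M]
      [IsManifold 𝓘(ℝ, EuclideanSpace ℝ (Fin m)) ∞ M] [T2Space M] [CompactSpace M]
      [SecondCountableTopology M] [MeasurableSpace M] [BorelSpace M] [ConnectedSpace M] [T3Space M]
      {h : ℝ → PseudoRiemannianMetric 𝓘(ℝ, EuclideanSpace ℝ (Fin m)) ∞ (EuclideanSpace ℝ (Fin m))
        (TangentSpace 𝓘(ℝ, EuclideanSpace ℝ (Fin m)) : M → Type _)}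
      {cov : ℝ → CovariantDerivative 𝓘(ℝ, EuclideanSpace ℝ (Fin m)) (EuclideanSpace ℝ (Fin m))
        (TangentSpace 𝓘(ℝ, EuclideanSpace ℝ (Fin m)) : M → Type _)}
      {a T : ℝ} (hflow : IsRicciFlow h cov (Icc a T)) (hh : IsContMDiffFamilyOn ∞ h univ)
      (hR : ∀ r, (h r).IsRiemannian),
      ∀ {t₀ r : ℝ} (ht₀ : t₀ ∈ Icc a T) (hb : t₀ - Tm₁ * r ^ 2 ∈ Icc a T), 0 < r →
      a < t₀ - (Tm₁ + 1) * r ^ 2 → ∀ x₀ : M,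
      (∀ (s : ℝ) (hs : s ∈ Icc a T) (y : M),
        (⟨⟨s, hs⟩, y⟩ : (ricciFlowMetricFlow hh hR Set.ordConnected_Icc hflow).Pt) ∈
          (ricciFlowMetricFlow hh hR Set.ordConnected_Icc hflow).pParabolicNhd ⟨⟨t₀, ht₀⟩, x₀⟩
            (A₂ * r) (Tm₁ * r ^ 2) 0 hb →
        ∀ τ ∈ Icc (s - r ^ 2) s, ∀ z : M, (h s).edist (hR s) y z < ENNReal.ofReal r →
        ∀ v : TangentSpace 𝓘(ℝ, EuclideanSpace ℝ (Fin m)) z,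
          |(cov τ).ricci z v v| ≤ K / r ^ 2 * (h τ).val z v v) →
      ∀ {t : ℝ} (ht : t ∈ Icc a T), t₀ - Tm₁ * r ^ 2 ≤ t → t ≤ t₀ → ∀ x : M,
      (h t₀).edist (hR t₀) x₀ x < ENNReal.ofReal (A₁ * r) →
      (⟨⟨t, ht⟩, x⟩ : (ricciFlowMetricFlow hh hR Set.ordConnected_Icc hflow).Pt) ∈
        (ricciFlowMetricFlow hh hR Set.ordConnected_Icc hflow).pParabolicNhd ⟨⟨t₀, ht₀⟩, x₀⟩
          (A₂ * r) (Tm₁ * r ^ 2) 0 hb := by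
  classical
  -- the one-step constant `A'` (slack Cor. 9.6 (a) at `(A, T⁻, T⁺) = (1/2, 1, 0)`)
  obtain ⟨A', hA', hsl⟩ := exists_mem_pParabolicNhd_of_ricci_bound m hm (A := 1 / 2) (K := K)
    (Tm := 1) (Tp := 0) (by norm_num) hK zero_le_one le_rfl
  -- numbers of steps
  set N : ℝ := ((⌈2 * A₁⌉₊ + 1 : ℕ) : ℝ) with hN
  set Kst : ℝ := ((⌈2 * Tm₁⌉₊ : ℕ) : ℝ) with hKst
  have hN0 : (0 : ℝ) ≤ N := by rw [hN]; exact Nat.cast_nonneg _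
  have hKst0 : 0 ≤ Kst := by rw [hKst]; exact Nat.cast_nonneg _
  have hA₁N : 2 * A₁ ≤ N := by
    rw [hN, Nat.cast_add, Nat.cast_one]
    linarith [Nat.le_ceil (2 * A₁)]
  have hTmK : 2 * Tm₁ ≤ Kst := by rw [hKst]; exact Nat.le_ceil _
  set A₂ : ℝ := 1 + (N + 1) * A' + Kst * A' with hA₂
  have hA₂pos : 0 < A₂ := by
    have : 0 ≤ (N + 1) * A' + Kst * A' := by positivity
    rw [hA₂]; linarith
  refine ⟨A₂, hA₂pos, ?_⟩
  intro M _ _ _ _ _ _ _ _ _ _ h cov a T hflow hh hR t₀ r ht₀ hb hr has x₀ hRicH t ht htb htt₀ x hxA₁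
  have hr2 : 0 < r ^ 2 := pow_pos hr 2
  -- the one-step implication
  have hstep := mem_pParabolicNhd_chain_step hflow hh hR hm ht₀ hb hr has x₀ (A₂ := A₂) hA'
    (fun s t hs ht hb' ↦ hsl hflow hh hR hs ht hb') hRicH
  -- the space chain: `t ∈ [t₀ − r², t₀]`
  have hj : ((⌈2 * A₁⌉₊ : ℕ) : ℝ) + 1 = N := by rw [hN, Nat.cast_add, Nat.cast_one]
  have hxN : (h t₀).edist (hR t₀) x₀ x <
      ENNReal.ofReal ((((⌈2 * A₁⌉₊ : ℕ) : ℝ) + 1) * (r / 2)) := by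
    refine hxA₁.trans_le (ENNReal.ofReal_le_ofReal ?_)
    rw [hj]
    have := mul_le_mul_of_nonneg_right hA₁N hr.le
    linarith
  have hspace : ∀ (t : ℝ) (ht : t ∈ Icc a T), t₀ - r ^ 2 ≤ t → t ≤ t₀ →
      (⟨⟨t, ht⟩, x⟩ : (ricciFlowMetricFlow hh hR Set.ordConnected_Icc hflow).Pt) ∈
        (ricciFlowMetricFlow hh hR Set.ordConnected_Icc hflow).pParabolicNhd ⟨⟨t₀, ht₀⟩, x₀⟩
          ((1 + N * A') * r) (Tm₁ * r ^ 2) 0 hb := by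
    intro t ht h1 h2
    have := mem_pParabolicNhd_chain_space hflow hh hR ht₀ hTm₁ hb hr x₀ hA' (N := N) (A₂ := A₂)
      (by rw [hA₂]; linarith [mul_nonneg hKst0 hA'.le]) hstep ⌈2 * A₁⌉₊ hj.le x hxN t ht h1 h2
    rwa [hj] at this
  -- the time chain: `k = ⌈2 T⁻₁⌉` reaches the base time
  have hfin := mem_pParabolicNhd_chain_time hflow hh hR ht₀ hTm₁ hb hr x₀ hA' (B₀ := 1 + N * A')
    (Kst := Kst) (A₂ := A₂) (by rw [hA₂]; linarith) hstep x hspace ⌈2 * Tm₁⌉₊ hKst.symm.le t ht ?_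
    htt₀
  · refine ⟨hfin.1, hfin.2.trans_le (ENNReal.ofReal_le_ofReal
      (mul_le_mul_of_nonneg_right ?_ hr.le))⟩
    rw [hA₂, ← hKst]; linarith
  · have h1 : t₀ - ((⌈2 * Tm₁⌉₊ : ℕ) : ℝ) * (r ^ 2 / 2) ≤ t₀ - Tm₁ * r ^ 2 + r ^ 2 := by
      have h3 := mul_le_mul_of_nonneg_right hTmK (by positivity : (0 : ℝ) ≤ r ^ 2 / 2)
      rw [← hKst]; linarith
    rw [max_eq_right h1, add_sub_cancel_right]
    exact htb

end Literature.Geometry.Riemannian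

end
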